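import Summits.RiemannHypothesis.RiemannHypothesis.Theorems.TiltedLandingLaw421R3PairSign
import Summits.RiemannHypothesis.RiemannHypothesis.Theorems.TiltedLandingLaw421R3PerturbativeRung

/-! # TiltedLandingLaw421R3PairCoherence — FIELD COHERENCE across a light pair: `‖K_z − K_v‖ ≤ (5 + 2M)/Im v` (K-2 step S10 / finding N2, lens-2 memo item 2) — W-08 C1 (rh-idea-5 g35)

SUPPORT module for crux `TiltedLandingLaw421R` ⟨stmt-RiemannHypothesis-33346⟩, route EarlyAppointments (`--supports … --as helper` only; no stub, no crux,
no law, no socket).  Imports: token 35's target `…R3PairSign` (C1 image D: `exists_pair_cofactor`, `logDeriv_pair_mul`; through it #1180 `RhW08.NewtonMate.newtonK_mate`)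
and tree #1179 `…R3PerturbativeRung`.  CONTENT = the DERIVED COHERENCE of lens-2's `K2-SOCKET-MEMO-v1` e536d809 item 2 (director (CA677): «booked with it»),
proved from the (sep) + (hull) clauses of the ruled notion `RhW08.PerturbativeRung2.LightPairAt` (lens-2 `PerturbativeRung2-v1.lean` 3808089f, GO-33-37 HELD)
WITHOUT importing it (the clauses are hypotheses VERBATIM in its `(t : ℂ) * (z - v)` form, so that module and this file are independent; D4 destructures
`LightPairAt` and feeds these lemmas by `exact`):
§1 ★ `norm_sub_le_of_hull` — the HEIGHT-WEIGHTED MEAN-VALUE BOUND on the segment: `0 < Im v < Im z`, `R` differentiable along `[v, z]` with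
`Im(u)²·‖R′(u)‖ ≤ M` ⇒ `‖R z − R v‖ ≤ M·‖z − v‖/(Im v·Im z)` — FREE of `Im z/Im v` (lens-2's «tall touchers cost nothing extra»).  Proof without integrals:
reparametrise the segment by `σ = 1/Im u ∈ [1/Im z, 1/Im v]`; then `‖d(R∘u)/dσ‖ ≤ M·‖z − v‖/(Im z − Im v)` is CONSTANT and the ordinary mean-value
inequality (`Convex.norm_image_sub_le_of_norm_hasDerivWithin_le`) on that interval of length `(Im z − Im v)/(Im v·Im z)` gives the claim.
§2 the three elementary pair differences: `norm_inv_sub_inv_eq`, self terms `‖(z − z̄)⁻¹ − (v − v̄)⁻¹‖ ≤ 1/(2·Im v)`, cross terms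
`‖(z − v)⁻¹ − (v − z)⁻¹‖ = 2/‖z − v‖`, conjugate-cross terms `‖(z − v̄)⁻¹ − (v − z̄)⁻¹‖ ≤ 1/(Im v + Im z)`; and `newtonK_pair` —
`K_w = (w − w̄)⁻¹ + (w − p)⁻¹ + (w − p̄)⁻¹ + g′(w)/g(w)` at either point of a pair factorisation `f⁽ʲ⁾ = (·−v)(·−v̄)(·−z)(·−z̄)·g`.
§3 ★★ `coherence_of_hull` — `‖newtonK f j z − newtonK f j v‖ ≤ (Im z − Im v)/(2·Im v·Im z) + 2/‖z − v‖ + 1/(Im v + Im z) + M·‖z − v‖/(Im v·Im z)`, and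
★★ `coherence_of_sep_touch` — with (sep) `Im v ≤ 2‖v − z‖` and the touch `|Re v − Re z| ≤ Im v + Im z`: **`‖K_z − K_v‖ ≤ (5 + 2M)/Im v`**
(memo: `(5.2 + 2.9M)·‖K_v‖/λ_v`, same currency `1/Im v = ‖K_v‖/(Im v·‖K_v‖)`).
What it is NOT: not the weights bookkeeping `w_z = (κ_v/‖K_z‖)²` itself (D4), not K-2, not RUNG-P, not C′.  Nothing here bears on the truth of RH; RH is NOT
proved; K-2 / RUNG-P / ★A / 33346 / 33347 OPEN; checked ≠ landed ≠ proved. -/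

namespace RhW08.PairCoherence

open Complex
open scoped ComplexConjugate
open RhW08.AntiEscapeSplit7 (newtonK)

/-! ## §1 The height-weighted mean-value bound on a segment -/

/-- ★ §1 **HEIGHT-WEIGHTED MEAN-VALUE BOUND**: `0 < Im v < Im z`, and along the segment `u_t = v + t·(z − v)` (`t : ℝ` coerced to ℂ — the form of
`RhW08.PerturbativeRung2.LightPairAt`), `t ∈ [0,1]`, `R` is ℂ-differentiable with `Im(u_t)²·‖R′(u_t)‖ ≤ M`.  THEN `‖R z − R v‖ ≤ M·‖z − v‖/(Im v·Im z)`.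
(Reparametrise by `σ = 1/Im u`: `u(σ) = v + ((σ⁻¹ − Im v)/(Im z − Im v))·(z − v)` has `Im u(σ) = σ⁻¹` and `‖(R∘u)′(σ)‖ ≤ M‖z − v‖/(Im z − Im v)`,
a constant; the σ-interval has length `1/Im v − 1/Im z`.) -/
theorem norm_sub_le_of_hull {R : ℂ → ℂ} {v z : ℂ} {M : ℝ} (ha : 0 < v.im) (hab : v.im < z.im)
    (hR : ∀ t : ℝ, 0 ≤ t → t ≤ 1 →
      DifferentiableAt ℂ R (v + (t : ℂ) * (z - v)) ∧ (v + (t : ℂ) * (z - v)).im ^ 2 * ‖deriv R (v + (t : ℂ) * (z - v))‖ ≤ M) :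
    ‖R z - R v‖ ≤ M * ‖z - v‖ / (v.im * z.im) := by
  set a : ℝ := v.im with hadef
  set b : ℝ := z.im with hbdef
  have hb : 0 < b := ha.trans hab
  set d : ℝ := b - a with hddef
  have hd : 0 < d := by rw [hddef]; linarith
  have hM : 0 ≤ M := by
    have h0 := (hR 0 le_rfl zero_le_one).2
    have h1 : (v + ((0 : ℝ) : ℂ) * (z - v)).im = a := by simp [hadef]
    rw [h1] at h0
    nlinarith [norm_nonneg (deriv R (v + ((0 : ℝ) : ℂ) * (z - v))), pow_pos ha 2]
  -- the reparametrisation `τ σ = (σ⁻¹ − a)/d`, `u σ = v + τ σ · (z − v)`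
  set τ : ℝ → ℝ := fun σ => (σ⁻¹ - a) / d with hτdef
  set u : ℝ → ℂ := fun σ => v + ((τ σ : ℝ) : ℂ) * (z - v) with hudef
  set φ : ℝ → ℂ := fun σ => R (u σ) with hφdef
  set s : Set ℝ := Set.Icc (1 / b) (1 / a) with hsdef
  have hσpos : ∀ σ ∈ s, 0 < σ := fun σ hσ => (one_div_pos.mpr hb).trans_le hσ.1
  have hτ01 : ∀ σ ∈ s, 0 ≤ τ σ ∧ τ σ ≤ 1 := by
    intro σ hσ
    have hσ0 := hσpos σ hσ
    have h1 : a ≤ σ⁻¹ := by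
      rw [le_inv_comm₀ ha hσ0]; simpa [one_div] using hσ.2
    have h2 : σ⁻¹ ≤ b := by
      rw [inv_le_comm₀ hσ0 hb]; simpa [one_div] using hσ.1
    refine ⟨div_nonneg (by linarith) hd.le, ?_⟩
    rw [div_le_one hd]; linarith
  have hu_im : ∀ σ ∈ s, (u σ).im = σ⁻¹ := by
    intro σ hσ
    have h1 : (u σ).im = a + τ σ * (b - a) := by
      simp only [hudef, add_im, Complex.im_ofReal_mul, sub_im, hadef, hbdef]
    rw [h1, hτdef]
    simp only
    field_simp
    ring
  -- derivative of `φ` on `s` and its constant bound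
  set C : ℝ := M * ‖z - v‖ / d with hCdef
  have hderiv : ∀ σ ∈ s, HasDerivWithinAt φ (deriv R (u σ) * ((((-(σ ^ 2)⁻¹) / d : ℝ) : ℂ) * (z - v))) s σ := by
    intro σ hσ
    have hσ0 := (hσpos σ hσ).ne'
    have hτ' : HasDerivAt τ ((-(σ ^ 2)⁻¹) / d) σ := ((hasDerivAt_inv hσ0).sub_const a).div_const d
    have hu' : HasDerivAt u ((((-(σ ^ 2)⁻¹) / d : ℝ) : ℂ) * (z - v)) σ := by
      have h1 := (hτ'.ofReal_comp).mul_const (z - v)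
      exact h1.const_add v
    have hRd : DifferentiableAt ℂ R (u σ) := (hR (τ σ) (hτ01 σ hσ).1 (hτ01 σ hσ).2).1
    exact (hRd.hasDerivAt.comp σ hu').hasDerivWithinAt
  have hbound : ∀ σ ∈ s, ‖deriv R (u σ) * ((((-(σ ^ 2)⁻¹) / d : ℝ) : ℂ) * (z - v))‖ ≤ C := by
    intro σ hσ
    have hσ0 := hσpos σ hσ
    have hRb : (u σ).im ^ 2 * ‖deriv R (u σ)‖ ≤ M := (hR (τ σ) (hτ01 σ hσ).1 (hτ01 σ hσ).2).2
    rw [hu_im σ hσ] at hRb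
    -- `hRb : σ⁻¹² · ‖R′(u σ)‖ ≤ M`
    have h1 : ‖deriv R (u σ)‖ ≤ M * σ ^ 2 := by
      have h2 := mul_le_mul_of_nonneg_right hRb (sq_nonneg σ)
      rwa [mul_comm (σ⁻¹ ^ 2), mul_assoc, show σ⁻¹ ^ 2 * σ ^ 2 = 1 by field_simp, mul_one] at h2
    have h3 : ‖((((-(σ ^ 2)⁻¹) / d : ℝ) : ℂ) * (z - v))‖ = (σ ^ 2)⁻¹ / d * ‖z - v‖ := by
      rw [norm_mul, Complex.norm_real, Real.norm_eq_abs, abs_div, abs_neg, abs_of_pos (by positivity), abs_of_pos hd]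
    rw [norm_mul, h3, hCdef]
    have h4 : M * σ ^ 2 * ((σ ^ 2)⁻¹ / d * ‖z - v‖) = M * ‖z - v‖ / d := by
      field_simp
    calc ‖deriv R (u σ)‖ * ((σ ^ 2)⁻¹ / d * ‖z - v‖) ≤ M * σ ^ 2 * ((σ ^ 2)⁻¹ / d * ‖z - v‖) :=
          mul_le_mul_of_nonneg_right h1 (by positivity)
      _ = M * ‖z - v‖ / d := h4
  have hmem_a : 1 / a ∈ s := ⟨one_div_le_one_div_of_le ha hab.le, le_rfl⟩
  have hmem_b : 1 / b ∈ s := ⟨le_rfl, one_div_le_one_div_of_le ha hab.le⟩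
  have hmvt := (convex_Icc (1 / b) (1 / a)).norm_image_sub_le_of_norm_hasDerivWithin_le hderiv hbound hmem_a hmem_b
  -- `φ (1/b) = R z`, `φ (1/a) = R v`, `‖1/b − 1/a‖ = d/(ab)`
  have hτa : τ (1 / a) = 0 := by simp [hτdef]
  have hτb : τ (1 / b) = 1 := by
    simp only [hτdef, one_div, inv_inv, hddef]
    exact div_self hd.ne'
  have hφa : φ (1 / a) = R v := by
    show R (v + ((τ (1 / a) : ℝ) : ℂ) * (z - v)) = R v
    rw [hτa, Complex.ofReal_zero, zero_mul, add_zero]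
  have hφb : φ (1 / b) = R z := by
    show R (v + ((τ (1 / b) : ℝ) : ℂ) * (z - v)) = R z
    rw [hτb, Complex.ofReal_one, one_mul, add_sub_cancel]
  have hlen : ‖1 / b - 1 / a‖ = d / (a * b) := by
    rw [Real.norm_eq_abs, abs_of_nonpos (by linarith [one_div_le_one_div_of_le ha hab.le]), hddef]
    field_simp
    ring
  rw [hφa, hφb, hlen, hCdef] at hmvt
  refine hmvt.trans (le_of_eq ?_)
  field_simp

/-! ## §2 The three elementary pair differences and the pair form of the field -/

/-- §2 `‖x⁻¹ − y⁻¹‖ = ‖y − x‖/(‖x‖·‖y‖)` for `x, y ≠ 0`. -/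
theorem norm_inv_sub_inv_eq {x y : ℂ} (hx : x ≠ 0) (hy : y ≠ 0) : ‖x⁻¹ - y⁻¹‖ = ‖y - x‖ / (‖x‖ * ‖y‖) := by
  have e : x⁻¹ - y⁻¹ = (y - x) / (x * y) := by
    field_simp
  rw [e, norm_div, norm_mul]

/-- §2 SELF (mate) terms: `0 < Im v ≤ Im z` ⇒ `‖(z − z̄)⁻¹ − (v − v̄)⁻¹‖ = (Im z − Im v)/(2·Im v·Im z) ≤ 1/(2·Im v)`. -/
theorem norm_self_diff_le {v z : ℂ} (ha : 0 < v.im) (hab : v.im ≤ z.im) :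
    ‖(z - conj z)⁻¹ - (v - conj v)⁻¹‖ = (z.im - v.im) / (2 * v.im * z.im) ∧
      ‖(z - conj z)⁻¹ - (v - conj v)⁻¹‖ ≤ 1 / (2 * v.im) := by
  have hb : 0 < z.im := ha.trans_le hab
  have ez : z - conj z = ((2 * z.im : ℝ) : ℂ) * I := by
    apply Complex.ext <;> simp [two_mul]
  have ev : v - conj v = ((2 * v.im : ℝ) : ℂ) * I := by
    apply Complex.ext <;> simp [two_mul]
  have hz0 : z - conj z ≠ 0 := by
    rw [ez]; exact mul_ne_zero (by exact_mod_cast (by positivity : (2 * z.im : ℝ) ≠ 0)) I_ne_zero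
  have hv0 : v - conj v ≠ 0 := by
    rw [ev]; exact mul_ne_zero (by exact_mod_cast (by positivity : (2 * v.im : ℝ) ≠ 0)) I_ne_zero
  have h1 : ‖(z - conj z)⁻¹ - (v - conj v)⁻¹‖ = (z.im - v.im) / (2 * v.im * z.im) := by
    rw [norm_inv_sub_inv_eq hz0 hv0, ez, ev, ← sub_mul, norm_mul, norm_mul, norm_mul, Complex.norm_I, ← Complex.ofReal_sub,
      Complex.norm_real, Complex.norm_real, Complex.norm_real, Real.norm_eq_abs, Real.norm_eq_abs, Real.norm_eq_abs,
      abs_of_pos (by positivity : (0 : ℝ) < 2 * z.im), abs_of_pos (by positivity : (0 : ℝ) < 2 * v.im),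
      abs_of_nonpos (by linarith : 2 * v.im - 2 * z.im ≤ 0)]
    field_simp
    ring
  refine ⟨h1, ?_⟩
  rw [h1, div_le_div_iff₀ (by positivity) (by positivity)]
  nlinarith

/-- §2 CROSS terms: `(z − v)⁻¹ − (v − z)⁻¹ = 2·(z − v)⁻¹`, so its norm is `2/‖z − v‖`. -/
theorem norm_cross_diff_eq (v z : ℂ) : ‖(z - v)⁻¹ - (v - z)⁻¹‖ = 2 / ‖z - v‖ := by
  have e : (z - v)⁻¹ - (v - z)⁻¹ = 2 * (z - v)⁻¹ := by
    rw [show v - z = -(z - v) by ring, inv_neg]; ring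
  rw [e, norm_mul, norm_inv, RCLike.norm_ofNat, div_eq_mul_inv]

/-- §2 CONJUGATE-CROSS terms: `v − z̄ = −conj (z − v̄)`, so `(z − v̄)⁻¹ − (v − z̄)⁻¹ = 2·Re((z − v̄)⁻¹)` and
`‖(z − v̄)⁻¹ − (v − z̄)⁻¹‖ = 2|Re z − Re v|/‖z − v̄‖² ≤ 1/(Im v + Im z)` (`2|Δ|(a+b) ≤ Δ² + (a+b)²`). -/
theorem norm_conj_cross_diff_le {v z : ℂ} (ha : 0 < v.im) (hb : 0 < z.im) :
    ‖(z - conj v)⁻¹ - (v - conj z)⁻¹‖ ≤ 1 / (v.im + z.im) := by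
  set x : ℂ := z - conj v with hxdef
  have hy : v - conj z = -conj x := by
    apply Complex.ext <;> simp [hxdef]
  have hxim : x.im = z.im + v.im := by simp [hxdef]
  have hx0 : x ≠ 0 := fun h0 => by
    have := congrArg Complex.im h0
    rw [hxim, zero_im] at this
    linarith
  have hN : 0 < Complex.normSq x := Complex.normSq_pos.mpr hx0
  have e : x⁻¹ - (-conj x)⁻¹ = (((2 * x.re) / Complex.normSq x : ℝ) : ℂ) := by
    rw [inv_neg, sub_neg_eq_add]
    apply Complex.ext
    · simp [Complex.inv_re, Complex.normSq_conj]
      ring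
    · simp [Complex.inv_im, Complex.normSq_conj]
      ring
  rw [hy, e, Complex.norm_real, Real.norm_eq_abs, abs_div, abs_of_pos hN, Complex.normSq_apply, hxim]
  rw [div_le_div_iff₀ (by nlinarith) (by positivity)]
  have h1 : |2 * x.re| * (v.im + z.im) ≤ x.re * x.re + (z.im + v.im) * (z.im + v.im) := by
    rcases le_or_gt 0 x.re with h | h
    · rw [abs_of_nonneg (by linarith)]
      nlinarith [sq_nonneg (x.re - (v.im + z.im))]
    · rw [abs_of_neg (by linarith)]
      nlinarith [sq_nonneg (x.re + (v.im + z.im))]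
  linarith

/-- §2 **THE PAIR FORM OF THE FIELD**: for `f⁽ʲ⁾ = (·−w)·((·−w̄)·((·−p)·((·−p̄)·g)))` with `g` differentiable at `w`, `g w ≠ 0`, `0 < Im w`, `0 < Im p`, `w ≠ p`:
`newtonK f j w = (w − w̄)⁻¹ + (w − p)⁻¹ + (w − p̄)⁻¹ + g′(w)/g(w)` (#1180 `newtonK_mate` + image D `logDeriv_pair_mul`). -/
theorem newtonK_pair {f g : ℂ → ℂ} {j : ℕ} {w p : ℂ} (hw : 0 < w.im) (hp : 0 < p.im) (hwp : w ≠ p) (hg : DifferentiableAt ℂ g w)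
    (hg0 : g w ≠ 0) (hF : ∀ u : ℂ, iteratedDeriv j f u = (u - w) * ((u - conj w) * ((u - p) * ((u - conj p) * g u)))) :
    newtonK f j w = (w - conj w)⁻¹ + (w - p)⁻¹ + (w - conj p)⁻¹ + deriv g w / g w := by
  have hwp' : w - p ≠ 0 := sub_ne_zero.mpr hwp
  have hwpb : w - conj p ≠ 0 := by
    refine sub_ne_zero.mpr fun e => ?_
    have h1 : w.im = -p.im := by rw [e, conj_im]
    linarith
  have hGd : DifferentiableAt ℂ (fun u : ℂ => (u - p) * ((u - conj p) * g u)) w := by fun_prop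
  have hGw : (w - p) * ((w - conj p) * g w) ≠ 0 := mul_ne_zero hwp' (mul_ne_zero hwpb hg0)
  rw [RhW08.NewtonMate.newtonK_mate hw.ne' hGd hGw hF, RhW08.PairSign.logDeriv_pair_mul hg hwp' hwpb hg0, one_div]
  ring

/-! ## §3 Coherence -/

/-- ★★ §3 **COHERENCE FROM THE HULL CLAUSE**: `f⁽ʲ⁾ = (·−v)(·−v̄)(·−z)(·−z̄)·g` (lens-2's left-associated form), `g` entire, `0 < Im v < Im z`, and on the
segment `[v, z]` the cofactor is zero-free with `Im(u)²·‖(g′/g)′(u)‖ ≤ M` (the (hull) clause of `LightPairAt`, verbatim).  THEN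
`‖K_z − K_v‖ ≤ (Im z − Im v)/(2·Im v·Im z) + 2/‖z − v‖ + 1/(Im v + Im z) + M·‖z − v‖/(Im v·Im z)` (`K_w = newtonK f j w`). -/
theorem coherence_of_hull {f g : ℂ → ℂ} {j : ℕ} {v z : ℂ} {M : ℝ} (hg : Differentiable ℂ g) (ha : 0 < v.im) (hab : v.im < z.im)
    (hF : ∀ u : ℂ, iteratedDeriv j f u = (u - v) * (u - conj v) * (u - z) * (u - conj z) * g u)
    (hhull : ∀ t : ℝ, 0 ≤ t → t ≤ 1 →
      g (v + (t : ℂ) * (z - v)) ≠ 0 ∧ (v + (t : ℂ) * (z - v)).im ^ 2 * ‖deriv (fun w => deriv g w / g w) (v + (t : ℂ) * (z - v))‖ ≤ M) :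
    ‖newtonK f j z - newtonK f j v‖ ≤
      (z.im - v.im) / (2 * v.im * z.im) + 2 / ‖z - v‖ + 1 / (v.im + z.im) + M * ‖z - v‖ / (v.im * z.im) := by
  have hb : 0 < z.im := ha.trans hab
  have hvz : v ≠ z := fun e => by rw [e] at hab; exact lt_irrefl _ hab
  have hgv : g v ≠ 0 := by simpa using (hhull 0 le_rfl zero_le_one).1
  have hgz : g z ≠ 0 := by simpa using (hhull 1 zero_le_one le_rfl).1
  have hFv : ∀ u : ℂ, iteratedDeriv j f u = (u - v) * ((u - conj v) * ((u - z) * ((u - conj z) * g u))) := fun u => by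
    rw [hF u]; ring
  have hFz : ∀ u : ℂ, iteratedDeriv j f u = (u - z) * ((u - conj z) * ((u - v) * ((u - conj v) * g u))) := fun u => by
    rw [hF u]; ring
  have hKv := newtonK_pair ha hb hvz hg.differentiableAt hgv hFv
  have hKz := newtonK_pair hb ha hvz.symm hg.differentiableAt hgz hFz
  -- the `R = g′/g` difference by §1
  set R : ℂ → ℂ := fun w => deriv g w / g w with hRdef
  have hR : ∀ t : ℝ, 0 ≤ t → t ≤ 1 →
      DifferentiableAt ℂ R (v + (t : ℂ) * (z - v)) ∧ (v + (t : ℂ) * (z - v)).im ^ 2 * ‖deriv R (v + (t : ℂ) * (z - v))‖ ≤ M := by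
    intro t h0 h1
    obtain ⟨hne, hbd⟩ := hhull t h0 h1
    exact ⟨((hg.analyticAt _).deriv.differentiableAt).div (hg _) hne, hbd⟩
  have hRb : ‖R z - R v‖ ≤ M * ‖z - v‖ / (v.im * z.im) := norm_sub_le_of_hull ha hab hR
  have e : newtonK f j z - newtonK f j v =
      ((z - conj z)⁻¹ - (v - conj v)⁻¹) + ((z - v)⁻¹ - (v - z)⁻¹) + ((z - conj v)⁻¹ - (v - conj z)⁻¹) + (R z - R v) := by
    rw [hKv, hKz]; ring
  rw [e]
  have h1 := (norm_self_diff_le ha hab.le).1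
  have h2 := norm_cross_diff_eq v z
  have h3 := norm_conj_cross_diff_le ha hb
  set A : ℂ := (z - conj z)⁻¹ - (v - conj v)⁻¹
  set B : ℂ := (z - v)⁻¹ - (v - z)⁻¹
  set C' : ℂ := (z - conj v)⁻¹ - (v - conj z)⁻¹
  set D : ℂ := R z - R v
  have t1 := norm_add_le (A + B + C') D
  have t2 := norm_add_le (A + B) C'
  have t3 := norm_add_le A B
  linarith

/-- ★★ §3 **COHERENCE OF A SEPARATED TOUCHING LIGHT PAIR**: under the hypotheses of `coherence_of_hull`, the (sep) clause `Im v ≤ 2‖v − z‖` and the touch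
`|Re v − Re z| ≤ Im v + Im z` (`Touches`), **`‖K_z − K_v‖ ≤ (5 + 2M)/Im v`**: self terms `≤ 1/(2 Im v)`, cross `2/‖z − v‖ ≤ 4/Im v`, conjugate-cross
`≤ 1/(Im v + Im z) ≤ 1/(2 Im v)`, hull `M‖z − v‖/(Im v·Im z) ≤ 2M/Im v` (`‖z − v‖ ≤ |Δ| + (Im z − Im v) ≤ 2·Im z`). -/
theorem coherence_of_sep_touch {f g : ℂ → ℂ} {j : ℕ} {v z : ℂ} {M : ℝ} (hg : Differentiable ℂ g) (ha : 0 < v.im) (hab : v.im < z.im)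
    (hF : ∀ u : ℂ, iteratedDeriv j f u = (u - v) * (u - conj v) * (u - z) * (u - conj z) * g u)
    (hhull : ∀ t : ℝ, 0 ≤ t → t ≤ 1 →
      g (v + (t : ℂ) * (z - v)) ≠ 0 ∧ (v + (t : ℂ) * (z - v)).im ^ 2 * ‖deriv (fun w => deriv g w / g w) (v + (t : ℂ) * (z - v))‖ ≤ M)
    (hsep : v.im ≤ 2 * ‖v - z‖) (ht : |v.re - z.re| ≤ v.im + z.im) :
    ‖newtonK f j z - newtonK f j v‖ ≤ (5 + 2 * M) / v.im := by
  have hb : 0 < z.im := ha.trans hab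
  have hM : 0 ≤ M := by
    have h0 := (hhull 0 le_rfl zero_le_one).2
    have h1 : (v + ((0 : ℝ) : ℂ) * (z - v)).im = v.im := by simp
    rw [h1] at h0
    nlinarith [norm_nonneg (deriv (fun w => deriv g w / g w) (v + ((0 : ℝ) : ℂ) * (z - v))), pow_pos ha 2]
  have hmain := coherence_of_hull hg ha hab hF hhull
  have hvz : 0 < ‖z - v‖ := by
    rw [norm_sub_rev]; linarith
  -- the four bounds in `1/Im v` currency
  have h1 : (z.im - v.im) / (2 * v.im * z.im) ≤ 1 / (2 * v.im) := by
    rw [div_le_div_iff₀ (by positivity) (by positivity)]; nlinarith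
  have h2 : 2 / ‖z - v‖ ≤ 4 / v.im := by
    rw [norm_sub_rev] at hvz ⊢
    rw [div_le_div_iff₀ hvz ha]; nlinarith
  have h3 : 1 / (v.im + z.im) ≤ 1 / (2 * v.im) := one_div_le_one_div_of_le (by positivity) (by linarith)
  have hzv : ‖z - v‖ ≤ 2 * z.im := by
    have h5 := Complex.norm_le_abs_re_add_abs_im (z - v)
    rw [sub_re, sub_im, abs_sub_comm z.re v.re, abs_of_pos (by linarith : 0 < z.im - v.im)] at h5
    linarith
  have h4 : M * ‖z - v‖ / (v.im * z.im) ≤ 2 * M / v.im := by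
    rw [div_le_div_iff₀ (by positivity) ha]
    have h6 : M * ‖z - v‖ ≤ M * (2 * z.im) := mul_le_mul_of_nonneg_left hzv hM
    nlinarith [mul_pos ha hb]
  have hsum : 1 / (2 * v.im) + 4 / v.im + 1 / (2 * v.im) + 2 * M / v.im = (5 + 2 * M) / v.im := by
    field_simp; ring
  linarith [hmain, h1, h2, h3, h4, hsum]

end RhW08.PairCoherence
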